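import Literature.Probability.Process.PlanarBrownianVec
import Literature.Probability.Process.BrownianVecStoppedIncrements
import Literature.Probability.Process.PlanarPotentials
import Literature.Probability.RandomPlanarGeometry.BrownianLoopMeasure
import HarnessLib

/-!
# Planar Brownian motion: hitting a small disc before leaving a large one (the `log`-ratio bound)

Proof file (theorems only) for the planar Brownian motion
`Z_t(ω) = B_t(ω₁) + i B_t(ω₂)` of the loop-measure file (`BrownianLoop.planarBrownian` on
`(WienerPair, wienerPair)`), whose vector form `![B_t(ω₁), B_t(ω₂)]` is a two-dimensional
Brownian motion in the sense of `Process.IsBrownianVec` (`Process.isBrownianVec_planar`). We prove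
the classical consequence of the harmonicity of `log |z − c|` (Le Gall (2016), Ch. 7, proof of
Thm. 7.17 / Prop. 7.16 in the plane: for `a < |w − c| < ρ` the Brownian motion from `w` reaches
the circle of radius `a` before the circle of radius `ρ` with probability
`log(ρ/|w − c|)/log(ρ/a)`), in the one-sided, finite-horizon form used by hitting estimates:

* `measure_hit_closedBall_le_log_add` — **for `0 < a < |w − c| < ρ` and every `t`,
  `P(∃ s ≤ t, w + Z_s ∈ B̄(c, a)) ≤ log(ρ/|w − c|)/log(ρ/a) + P(∃ s ≤ t, |w + Z_s − c| ≥ ρ)`**: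
  optional stopping of `log |X − c|` at the exit time of the annulus
  (`IsBrownianVec.integral_stoppedProcess_eq_of_harmonic` with the planar logarithmic potential of
  `Process/PlanarPotentials`) and Markov's inequality.

Also recorded: the dictionary between the vector model `Fin 2 → ℝ` and `ℂ`
(`toC v = v 0 + v 1 · i`, written as an explicit lambda: its continuity, additivity, norm, and the
identity `toC ![B(ω₁), B(ω₂)] = Z`). No definition and no named fact is introduced.

## References

* J.-F. Le Gall, *Brownian Motion, Martingales, and Stochastic Calculus*, GTM 274 (2016), Ch. 7,
  Prop. 7.16, Thm. 7.17 and their proofs (exit of an annulus through `log`). [Legall2016]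
-/

noncomputable section

open MeasureTheory ProbabilityTheory Filter Set Metric Complex
open scoped NNReal ENNReal Topology

namespace Literature.Probability.RandomPlanarGeometry

open Literature.Probability.Process
open BrownianLoop (planarBrownian)

/-! ### The dictionary `ℝ² → ℂ` -/

/-- `v ↦ v 0 + v 1 · i` is continuous. [folklore] -/
theorem continuous_toC : Continuous fun v : Fin 2 → ℝ ↦ (v 0 : ℂ) + (v 1 : ℂ) * I := by
  fun_prop

/-- `v ↦ v 0 + v 1 · i` is additive. [folklore] -/
theorem toC_add (u v : Fin 2 → ℝ) :
    (((u + v) 0 : ℝ) : ℂ) + (((u + v) 1 : ℝ) : ℂ) * I = ((u 0 : ℂ) + (u 1 : ℂ) * I) + ((v 0 : ℂ) + (v 1 : ℂ) * I) := by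
  simp only [Pi.add_apply, ofReal_add]
  ring

/-- The distance to `c` in the dictionary: `|v 0 + v 1 i − c| = √((v 0 − Re c)² + (v 1 − Im c)²)`.
[folklore] -/
theorem norm_toC_sub (v : Fin 2 → ℝ) (c : ℂ) :
    ‖(v 0 : ℂ) + (v 1 : ℂ) * I - c‖ = Real.sqrt ((v 0 - c.re) ^ 2 + (v 1 - c.im) ^ 2) := by
  have h : (v 0 : ℂ) + (v 1 : ℂ) * I - c = ((v 0 - c.re : ℝ) : ℂ) + ((v 1 - c.im : ℝ) : ℂ) * I := by
    apply Complex.ext <;> simp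
  rw [h, norm_add_mul_I]

/-- The logarithmic potential of `PlanarPotentials` is `log |toC v − c|`. [folklore] -/
theorem logDist_eq_log_norm (v : Fin 2 → ℝ) (c : ℂ) :
    Real.log ((v 0 - c.re) ^ 2 + (v 1 - c.im) ^ 2) / 2 = Real.log ‖(v 0 : ℂ) + (v 1 : ℂ) * I - c‖ := by
  rw [norm_toC_sub, Real.log_sqrt (by positivity)]

/-- The sup norm of `v` is at most `|toC v|`. [folklore] -/
theorem norm_le_norm_toC (v : Fin 2 → ℝ) : ‖v‖ ≤ ‖(v 0 : ℂ) + (v 1 : ℂ) * I‖ := by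
  rw [norm_add_mul_I]
  refine (pi_norm_le_iff_of_nonneg (Real.sqrt_nonneg _)).2 fun i ↦ ?_
  fin_cases i
  · simpa using Real.abs_le_sqrt (by nlinarith [sq_nonneg (v 1)] : v 0 ^ 2 ≤ v 0 ^ 2 + v 1 ^ 2)
  · simpa using Real.abs_le_sqrt (by nlinarith [sq_nonneg (v 0)] : v 1 ^ 2 ≤ v 0 ^ 2 + v 1 ^ 2)

/-- The vector `![Re w, Im w]` is sent to `w`. [folklore] -/
theorem toC_reIm (w : ℂ) : (((![w.re, w.im] : Fin 2 → ℝ) 0 : ℝ) : ℂ) + (((![w.re, w.im] : Fin 2 → ℝ) 1 : ℝ) : ℂ) * I = w := by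
  simp [re_add_im]

/-- **The vector model read in `ℂ` is the planar Brownian motion**, started at `w`:
`toC (![Re w, Im w] + ![B_s(ω₁), B_s(ω₂)]) = w + Z_s(ω)`. [folklore] -/
theorem toC_start_add_planar (w : ℂ) (s : ℝ≥0) (ω : WienerPair) :
    ((((![w.re, w.im] : Fin 2 → ℝ) + ![brownian s ω.1, brownian s ω.2]) 0 : ℝ) : ℂ) +
        ((((![w.re, w.im] : Fin 2 → ℝ) + ![brownian s ω.1, brownian s ω.2]) 1 : ℝ) : ℂ) * I =
      w + planarBrownian s ω := by
  rw [toC_add, toC_reIm]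
  rfl

/-- Preimages of closed sets of `ℂ` under the dictionary are closed. [folklore] -/
theorem isClosed_preimage_toC {S : Set ℂ} (hS : IsClosed S) :
    IsClosed {v : Fin 2 → ℝ | (v 0 : ℂ) + (v 1 : ℂ) * I ∈ S} :=
  hS.preimage continuous_toC

/-- A set of vectors whose images lie in a bounded set of `ℂ` is bounded. [folklore] -/
theorem isBounded_of_norm_toC_le {S : Set (Fin 2 → ℝ)} {R : ℝ}
    (h : ∀ v ∈ S, ‖(v 0 : ℂ) + (v 1 : ℂ) * I‖ ≤ R) : Bornology.IsBounded S :=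
  (Metric.isBounded_closedBall (x := (0 : Fin 2 → ℝ)) (r := R)).subset fun v hv ↦ by
    rw [mem_closedBall, dist_zero_right]
    exact (norm_le_norm_toC v).trans (h v hv)

/-! ### Hitting a small disc before leaving a large one -/

/-- **The `log`-ratio bound.** Let `0 < a < |w − c| < ρ`. For every horizon `t`, the probability
that the planar Brownian motion started at `w` visits the closed disc `B̄(c, a)` by time `t` is at
most `log(ρ/|w − c|)/log(ρ/a)` plus the probability that it reaches distance `ρ` from `c` by time
`t`. (Optional stopping for the harmonic function `log |· − c|` at the exit time `T` of the
annulus `{a < |z − c| < ρ}`: `E[log |X_{t∧T} − c|] = log |w − c|`, the stopped value lies in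
`[log a, log ρ]` and equals `log a` on the event in question unless the outer circle was reached;
Markov's inequality.) [cite: Legall2016, Ch. 7 Prop. 7.16 / Thm. 7.17 (proofs, planar case)] -/
theorem measure_hit_closedBall_le_log_add {c w : ℂ} {a ρ : ℝ} (ha : 0 < a) (haw : a < ‖w - c‖)
    (hwρ : ‖w - c‖ < ρ) (t : ℝ≥0) :
    wienerPair {ω | ∃ s ≤ t, w + planarBrownian s ω ∈ closedBall c a} ≤
      ENNReal.ofReal (Real.log (ρ / ‖w - c‖) / Real.log (ρ / a)) +
        wienerPair {ω | ∃ s ≤ t, ρ ≤ ‖w + planarBrownian s ω - c‖} := by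
  have hρ : 0 < ρ := lt_trans (lt_trans ha haw) hwρ
  have hwc : 0 < ‖w - c‖ := lt_trans ha haw
  -- the vector model
  set W : ℝ≥0 → WienerPair → (Fin 2 → ℝ) := fun t ω ↦ ![brownian t ω.1, brownian t ω.2] with hWdef
  have hW : IsBrownianVec W wienerPair := isBrownianVec_planar
  set x₀ : Fin 2 → ℝ := ![w.re, w.im] with hx₀
  -- notation: `N v = |toC v − c|`
  set N : (Fin 2 → ℝ) → ℝ := fun v ↦ ‖(v 0 : ℂ) + (v 1 : ℂ) * I - c‖ with hNdef
  have hNcont : Continuous N := (continuous_toC.sub continuous_const).norm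
  have hNX : ∀ s ω, N (x₀ + W s ω) = ‖w + planarBrownian s ω - c‖ := fun s ω ↦ by
    simp only [hNdef, hx₀, hWdef]
    rw [toC_start_add_planar]
  have hNx₀ : N x₀ = ‖w - c‖ := by simp only [hNdef, hx₀]; rw [toC_reIm]
  -- the potential, the annulus
  set V : (Fin 2 → ℝ) → ℝ := fun v ↦ Real.log ((v 0 - c.re) ^ 2 + (v 1 - c.im) ^ 2) / 2 with hVdef
  have hVN : ∀ v, V v = Real.log (N v) := fun v ↦ logDist_eq_log_norm v c
  set U : Set (Fin 2 → ℝ) := {v | (v 0 - c.re) ^ 2 + (v 1 - c.im) ^ 2 ≠ 0} with hUdef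
  have hUN : ∀ v, v ∈ U ↔ N v ≠ 0 := fun v ↦ by
    simp only [hUdef, mem_setOf_eq, hNdef, norm_toC_sub]
    rw [not_iff_not, Real.sqrt_eq_zero (by positivity)]
  set F : Set (Fin 2 → ℝ) := {v | N v ≤ a} ∪ {v | ρ ≤ N v} with hFdef
  have hF : IsClosed F := (isClosed_le hNcont continuous_const).union (isClosed_le continuous_const hNcont)
  have hFc : Fᶜ = {v | a < N v ∧ N v < ρ} := by
    ext v; simp [hFdef, not_le]
  have hbdd : Bornology.IsBounded Fᶜ := by
    refine isBounded_of_norm_toC_le (R := ‖c‖ + ρ) fun v hv ↦ ?_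
    rw [hFc] at hv
    have h1 : ‖(v 0 : ℂ) + (v 1 : ℂ) * I‖ ≤ ‖(v 0 : ℂ) + (v 1 : ℂ) * I - c‖ + ‖c‖ := norm_le_norm_sub_add _ _
    have h2 : N v < ρ := hv.2
    simp only [hNdef] at h2
    linarith
  have hclF : closure Fᶜ ⊆ {v | a ≤ N v ∧ N v ≤ ρ} := by
    rw [hFc]
    refine closure_minimal (fun v hv ↦ ⟨hv.1.le, hv.2.le⟩) ?_
    exact (isClosed_le continuous_const hNcont).inter (isClosed_le hNcont continuous_const)
  have hFU : closure Fᶜ ⊆ U := fun v hv ↦ (hUN v).2 (lt_of_lt_of_le ha (hclF hv).1).ne'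
  have hx₀F : x₀ ∉ F := by
    simp only [hFdef, mem_union, mem_setOf_eq, hNx₀, not_or, not_le]
    exact ⟨haw, hwρ⟩
  have hΔ : ∀ y ∈ U, lap V y = 0 := fun y hy ↦ lap_logDist_eq_zero c.re c.im hy
  obtain ⟨hint, hEV⟩ := hW.integral_stoppedProcess_eq_of_harmonic (isOpen_sqDist_ne_zero c.re c.im)
    (contDiffOn_logDist c.re c.im) hΔ hF hbdd hFU hx₀F t
  -- the stopped value `Y = log |X_{t∧T} − c|`
  set T := IsBrownianVec.hitTime x₀ W F with hTdef
  set Y : WienerPair → ℝ := stoppedProcess (fun r ω ↦ V (x₀ + W r ω)) T t with hYdef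
  have hYval : ∀ ω, Y ω = Real.log (N (x₀ + W (min (t : WithTop ℝ≥0) (T ω)).untopA ω)) := fun ω ↦ by
    simp only [hYdef, stoppedProcess, hVN]
  have hmemcl : ∀ ω, x₀ + W (min (t : WithTop ℝ≥0) (T ω)).untopA ω ∈ closure Fᶜ := fun ω ↦
    hW.mem_closure_compl_of_le hF hx₀F t ω le_rfl
  have hYle : ∀ ω, Y ω ≤ Real.log ρ := fun ω ↦ by
    rw [hYval]
    have h := hclF (hmemcl ω)
    exact Real.log_le_log (lt_of_lt_of_le ha h.1) h.2
  have hYge : ∀ ω, Real.log a ≤ Y ω := fun ω ↦ by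
    rw [hYval]
    exact Real.log_le_log ha (hclF (hmemcl ω)).1
  -- the events
  set H : Set WienerPair := {ω | ∃ s ≤ t, w + planarBrownian s ω ∈ closedBall c a} with hHdef
  set G : Set WienerPair := {ω | ∃ s ≤ t, ρ ≤ ‖w + planarBrownian s ω - c‖} with hGdef
  -- on `H \ G` the stopped value is `log a`
  have hYeq : ∀ ω ∈ H \ G, Y ω = Real.log a := by
    rintro ω ⟨⟨s, hst, hs⟩, hωG⟩
    have hsF : x₀ + W s ω ∈ F := by
      left
      show N (x₀ + W s ω) ≤ a
      rw [hNX]; simpa [mem_closedBall, dist_eq_norm] using hs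
    have hTs : T ω ≤ s := IsBrownianVec.hitTime_le_of_mem hsF
    obtain ⟨T₀, hT₀⟩ := WithTop.ne_top_iff_exists.1 (ne_top_of_le_ne_top WithTop.coe_ne_top hTs)
    have hT₀s : T₀ ≤ s := by rw [← hT₀] at hTs; exact WithTop.coe_le_coe.1 hTs
    have hT₀t : T₀ ≤ t := hT₀s.trans hst
    have hmin : (min (t : WithTop ℝ≥0) (T ω)).untopA = T₀ := by
      rw [← hT₀, untopA_min_coe_coe, min_eq_right hT₀t]
    have hXF : x₀ + W T₀ ω ∈ F := hW.mem_of_hitTime_eq_coe hF hT₀.symm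
    have hXcl : a ≤ N (x₀ + W T₀ ω) ∧ N (x₀ + W T₀ ω) ≤ ρ := by
      have := hclF (hmemcl ω); rwa [hmin] at this
    have hnot : ¬ ρ ≤ N (x₀ + W T₀ ω) := fun h ↦ hωG ⟨T₀, hT₀t, by rwa [hNX] at h⟩
    have hXa : N (x₀ + W T₀ ω) ≤ a := hXF.resolve_right hnot
    rw [hYval, hmin, le_antisymm hXa hXcl.1]
  -- Markov's inequality for `log ρ − Y ≥ 0`
  have hpos : 0 < Real.log ρ - Real.log a := sub_pos.2 (Real.log_lt_log ha (haw.trans hwρ))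
  have hfint : Integrable (fun ω ↦ Real.log ρ - Y ω) wienerPair := (integrable_const _).sub hint
  have hmarkov := mul_meas_ge_le_integral_of_nonneg (μ := wienerPair)
    (ae_of_all _ fun ω ↦ sub_nonneg.2 (hYle ω)) hfint (Real.log ρ - Real.log a)
  rw [integral_sub (integrable_const _) hint, integral_const, hEV, smul_eq_mul, probReal_univ,
    one_mul] at hmarkov
  have hx₀V : Real.log ((x₀ 0 - c.re) ^ 2 + (x₀ 1 - c.im) ^ 2) / 2 = Real.log ‖w - c‖ := by
    rw [logDist_eq_log_norm, ← hNx₀]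
  rw [hx₀V] at hmarkov
  -- `P(H \ G) ≤ log(ρ/|w−c|)/log(ρ/a)`
  have hsub : H \ G ⊆ {ω | Real.log ρ - Real.log a ≤ Real.log ρ - Y ω} := fun ω hω ↦ by
    show Real.log ρ - Real.log a ≤ Real.log ρ - Y ω
    rw [hYeq ω hω]
  have hHG : wienerPair (H \ G) ≤ ENNReal.ofReal (Real.log (ρ / ‖w - c‖) / Real.log (ρ / a)) := by
    refine (measure_mono hsub).trans ?_
    rw [← ENNReal.ofReal_toReal (measure_ne_top wienerPair _), ← measureReal_def]
    refine ENNReal.ofReal_le_ofReal ?_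
    rw [Real.log_div hρ.ne' hwc.ne', Real.log_div hρ.ne' ha.ne', le_div_iff₀ hpos, mul_comm]
    exact hmarkov
  calc wienerPair H ≤ wienerPair ((H \ G) ∪ G) := measure_mono fun ω hω ↦ by
        by_cases hG : ω ∈ G
        · exact Or.inr hG
        · exact Or.inl ⟨hω, hG⟩
    _ ≤ wienerPair (H \ G) + wienerPair G := measure_union_le _ _
    _ ≤ _ := add_le_add hHG le_rfl

end Literature.Probability.RandomPlanarGeometry

end
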